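import Summits.Langlands.Langlands.Statement
import Summits.Langlands.Langlands.Theorems.ParityBlindBianchiArtinWeightRealisationLevelStubTwistDictionaryAt
import Literature.NumberTheory.Automorphic.AutomorphicTwistBJ
import Literature.NumberTheory.Automorphic.PairLFunctionMeromorphicContinuationRankNeTwistProofs
import Literature.NumberTheory.Automorphic.LanglandsTetrahedral
import Literature.NumberTheory.GaloisRepresentations.ArtinCharacterReciprocityProofs
import Literature.NumberTheory.GaloisRepresentations.TateTwistFrobeniusProofs
import HarnessLib

/-!
# Stub `stub_twistedRealisation` (S5) of the line `SketchIdeator2` for the crux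
# `ParityBlindBianchi.ArtinWeightRealisationEven` (item stmt-Langlands-16619)

Twisting back.  Let `K` be a number field, `ι : ℚ̄_p ≃+* ℂ`, `σ r : Γ_K →ₜ* GL₂(ℚ̄_p)`,
`χ : Γ_K →* ℚ̄_pˣ` with `χ² = 1` and `M ∈ GL₂(ℚ̄_p)` with `r(g) = χ(g) · M σ(g) M⁻¹` for all `g`,
and let `π` be a cuspidal automorphic representation of `GL₂(𝔸_K)` which is Satake–Frobenius
compatible with `r` (`Summit.Langlands.SatakeFrobCompatibleAt`, arithmetic normalisation) at every
good place `w` (a place above no prime of `S₀`), where moreover `σ` is unramified.  Then the twist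
`π ⊗ (ω ∘ det)` of `π` by the finite-order Hecke character `ω` attached to `χ` by Artin reciprocity
is Satake–Frobenius compatible with `σ` at every good place.

Proof.
1. `χ` takes the values `±1` (`χ² = 1` in a field) and `g ↦ χ(g) = (r(g) (M σ(g) M⁻¹)⁻¹)₀₀` is
   continuous, so `ker χ = χ⁻¹({-1}ᶜ)` is open; hence `g ↦ ι(χ(g)) ∈ ℂˣ = GL₁(ℂ)` is a rank-one
   framed Artin representation `χℂ` (continuity from the open kernel).
2. At a good place `w`, `r` and `σ` are trivial on the inertia groups above `w`, so
   `χ(τ) · 1 = r(τ) (M σ(τ) M⁻¹)⁻¹ = 1`: `χℂ` is unramified at `w`.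
3. Artin reciprocity (`artinReciprocity_character_holds`, proved in the tree) gives a finite-order
   Hecke character `ω`, unramified at every such `w`, with `ι(χ(Φ)) = ω(ϖ_w)` for every arithmetic
   Frobenius `Φ` above `w`.
4. The Borel–Jacquet twist `π ⊗ (ω ∘ det)` (`CuspidalAutomorphicRepData.twist`) has Satake
   parameter `ω(ϖ_w) · α` at `w` (`HasSatakeParamAt.twist_of_isUnramifiedAt`, at a level of `ω`
   prime to `w`, `HeckeCharacter.exists_level_not_dvd_of_isUnramifiedAt`).
5. `charpoly σ(Φ) = charpoly (M σ(Φ) M⁻¹) = charpoly (χ(Φ)⁻¹ · r(Φ))`, whose roots are those of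
   `charpoly r(Φ) = ∏ (X - ι⁻¹(α_j⁻¹))` multiplied by `χ(Φ)⁻¹ = ι⁻¹(ω(ϖ_w)⁻¹)`
   (`Matrix.charpoly_smul_of_eq_prod`), i.e. `∏ (X - ι⁻¹((ω(ϖ_w) α_j)⁻¹))`, the arithmetic
   Frobenius polynomial of the Satake parameter `ω(ϖ_w) · α`.

Reused tree facts: `MonoidHom.continuous_of_isOpen_ker` (`Automorphic.LanglandsTetrahedral`),
`ArtinWeightRealisationLevel.arithFrobPolyOfSatake_one_eq_prod_map` / `…_one_map_mul`
(`ParityBlindBianchiArtinWeightRealisationLevelStubTwistDictionaryAt`),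
`Matrix.charpoly_smul_of_eq_prod` (`GaloisRepresentations.TateTwistFrobeniusProofs`),
`FramedRep.unitsContinuousMulEquivOfUnique`, `exists_heckeCharacter_apply_frob_eq`.

References: J. Tate, *Global class field theory*, in Cassels–Fröhlich (1967), Ch. VII §5.1;
J. Arthur, L. Clozel, Ann. of Math. Stud. 120 (1989), Ch. 3, p. 172 (`t_{π ⊗ η, v} = η(ϖ_v) t_{π,v}`);
J.-P. Serre, *Abelian ℓ-adic representations* (1968), Ch. I §1.1, §2.3.
-/

-- the line's namespace `Summit.Langlands.Langlands.…` (summit = problem = `Langlands`) repeats a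
-- component by design
set_option linter.dupNamespace false

namespace Summit.Langlands.Langlands.Theorems.ArtinWeightRealisationEven

open scoped MatrixGroups Matrix Polynomial NumberField
open NumberField IsDedekindDomain Polynomial Field
open Literature.NumberTheory.Automorphic Literature.NumberTheory.GaloisRepresentations

namespace TwistedRealisation

/-! ### Generic algebra over a field -/

section Generic

variable {A : Type*} [Field A]

/-- In a field, a unit of square `1` is `±1`. [folklore] -/
theorem val_eq_or_of_sq_eq_one {u : Aˣ} (h : u ^ 2 = 1) : (u : A) = 1 ∨ (u : A) = -1 := by
  have h' := congrArg Units.val h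
  rw [Units.val_pow_eq_pow_val, Units.val_one] at h'
  exact sq_eq_one_iff.mp h'

/-- If `R = c • N` with `N` invertible, then `c` is the `(0,0)` entry of `R N⁻¹`. [folklore] -/
theorem eq_mul_inv_apply {c : A} {R N : GL (Fin 2) A}
    (h : (R : Matrix (Fin 2) (Fin 2) A) = c • (N : Matrix (Fin 2) (Fin 2) A)) :
    c = ((R : Matrix (Fin 2) (Fin 2) A) * ((N⁻¹ : GL (Fin 2) A) : Matrix (Fin 2) (Fin 2) A)) 0 0 := by
  rw [h, Matrix.smul_mul, Units.mul_inv, Matrix.smul_apply, Matrix.one_apply_eq, smul_eq_mul,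
    mul_one]

/-- If `R = c • M S M⁻¹` with `R = 1` and `S = 1`, then `c = 1`. [folklore] -/
theorem eq_one_of_eq_smul_conj {c : A} {R S M : GL (Fin 2) A} (hR : R = 1) (hS : S = 1)
    (h : (R : Matrix (Fin 2) (Fin 2) A) =
      c • ((M * S * M⁻¹ : GL (Fin 2) A) : Matrix (Fin 2) (Fin 2) A)) : c = 1 := by
  rw [hR, hS, mul_one, mul_inv_cancel, Units.val_one] at h
  have h00 := congrFun (congrFun h 0) 0
  rw [Matrix.smul_apply, Matrix.one_apply_eq, smul_eq_mul, mul_one] at h00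
  exact h00.symm

/-- **Characteristic polynomial of a twisted conjugate.**  If `R = c • M S M⁻¹` with `c ≠ 0` and
`charpoly R = ∏_{b ∈ β} (X - b)`, then `charpoly S = ∏_{b ∈ β} (X - c⁻¹ b)` (invariance under
conjugation, Mathlib `Matrix.charpoly_units_conj`, and rescaling of the roots,
`Matrix.charpoly_smul_of_eq_prod`). [folklore] -/
theorem charpoly_eq_of_eq_smul_conj {c : A} (hc : c ≠ 0) {R S M : GL (Fin 2) A}
    {β : Multiset A}
    (h : (R : Matrix (Fin 2) (Fin 2) A) =
      c • ((M * S * M⁻¹ : GL (Fin 2) A) : Matrix (Fin 2) (Fin 2) A))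
    (hR : (R : Matrix (Fin 2) (Fin 2) A).charpoly = (β.map fun b => X - C b).prod) :
    (S : Matrix (Fin 2) (Fin 2) A).charpoly = (β.map fun b => X - C (c⁻¹ * b)).prod := by
  have h1 : ((M * S * M⁻¹ : GL (Fin 2) A) : Matrix (Fin 2) (Fin 2) A) =
      c⁻¹ • (R : Matrix (Fin 2) (Fin 2) A) := by
    rw [h, smul_smul, inv_mul_cancel₀ hc, one_smul]
  have h2 : (S : Matrix (Fin 2) (Fin 2) A).charpoly =
      ((M * S * M⁻¹ : GL (Fin 2) A) : Matrix (Fin 2) (Fin 2) A).charpoly := by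
    rw [Units.val_mul, Units.val_mul, Matrix.coe_units_inv, Matrix.charpoly_units_conj]
  rw [h2, h1]
  exact Matrix.charpoly_smul_of_eq_prod hR (inv_ne_zero hc)

end Generic

end TwistedRealisation

open TwistedRealisation
open Summit.Langlands.Langlands.Theorems.ArtinWeightRealisationLevel
  (arithFrobPolyOfSatake_one_eq_prod_map arithFrobPolyOfSatake_one_map_mul)

/-- **S5 (twisting back).**  If `r = χ · M σ M⁻¹` with `χ² = 1` and a cuspidal `π` of `GL₂(𝔸_K)`
is Satake–Frobenius compatible with `r` at every good place (where `σ` is unramified), then the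
Borel–Jacquet twist `π ⊗ (ω ∘ det)` of `π` by the finite-order Hecke character `ω` attached by
Artin reciprocity (`artinReciprocity_character_holds`) to the complex character `ι ∘ χ` (continuous:
its kernel is open) is Satake–Frobenius compatible with `σ` at every good place: at such a `w`,
`ι(χ(Frob_w)) = ω(ϖ_w)`, the Satake parameter of the twist is `ω(ϖ_w) · α`
(`HasSatakeParamAt.twist_of_isUnramifiedAt`), and `charpoly σ(Frob_w) = charpoly (χ(Frob_w)⁻¹ r(Frob_w))`
has the roots `ι⁻¹((ω(ϖ_w) α_j)⁻¹)`.  Tate, Cassels–Fröhlich Ch. VII §5.1; Arthur–Clozel (1989),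
Ch. 3, p. 172. [folklore] -/
theorem stub_twistedRealisation :
    ∀ (K : Type) [Field K] [NumberField K] (p : ℕ) [Fact p.Prime] (ι : PadicAlgCl p ≃+* ℂ)
      (σ r : FramedGaloisRep K (PadicAlgCl p) 2) (χ : absoluteGaloisGroup K →* (PadicAlgCl p)ˣ)
      (M : GL (Fin 2) (PadicAlgCl p)), (∀ g, χ g ^ 2 = 1) →
      (∀ g : absoluteGaloisGroup K, ((r g : GL (Fin 2) (PadicAlgCl p)) : Matrix (Fin 2) (Fin 2) (PadicAlgCl p)) =
        ((χ g : (PadicAlgCl p)ˣ) : PadicAlgCl p) •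
          ((M * σ g * M⁻¹ : GL (Fin 2) (PadicAlgCl p)) : Matrix (Fin 2) (Fin 2) (PadicAlgCl p))) →
      ∀ (S₀ : Finset ℕ) (hcpt : isCompact_glFiniteIntegralLevel 2 K) (π : CuspidalAutomorphicRepData 2 K hcpt),
      (∀ w : HeightOneSpectrum (𝓞 K), (∀ ℓ ∈ S₀, ((ℓ : ℕ) : 𝓞 K) ∉ w.asIdeal) →
        σ.IsUnramifiedAt w ∧ SatakeFrobCompatibleAt ι π.1 r w) →
      ∃ (hcpt' : isCompact_glFiniteIntegralLevel 2 K) (π' : CuspidalAutomorphicRepData 2 K hcpt'),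
        ∀ w : HeightOneSpectrum (𝓞 K), (∀ ℓ ∈ S₀, ((ℓ : ℕ) : 𝓞 K) ∉ w.asIdeal) →
          SatakeFrobCompatibleAt ι π'.1 σ w := by
  intro K _ _ p _ ι σ r χ M hχ2 hrχ S₀ hcpt π hgood
  -- Step 1: `χ = ±1` is continuous, i.e. has open kernel
  have hpm : ∀ g : absoluteGaloisGroup K, ((χ g : (PadicAlgCl p)ˣ) : PadicAlgCl p) = 1 ∨
      ((χ g : (PadicAlgCl p)ˣ) : PadicAlgCl p) = -1 :=
    fun g => val_eq_or_of_sq_eq_one (A := PadicAlgCl p) (hχ2 g)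
  have hNc : Continuous fun g : absoluteGaloisGroup K =>
      (M * σ g * M⁻¹ : GL (Fin 2) (PadicAlgCl p)) :=
    (continuous_const.mul (map_continuous σ)).mul continuous_const
  have hc : Continuous fun g : absoluteGaloisGroup K =>
      (((r g : GL (Fin 2) (PadicAlgCl p)) : Matrix (Fin 2) (Fin 2) (PadicAlgCl p)) *
        (((M * σ g * M⁻¹)⁻¹ : GL (Fin 2) (PadicAlgCl p)) : Matrix (Fin 2) (Fin 2) (PadicAlgCl p))) 0 0 :=
    ((Units.continuous_val.comp (map_continuous r)).matrix_mul
      (Units.continuous_coe_inv.comp hNc)).matrix_elem 0 0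
  have hf : Continuous fun g : absoluteGaloisGroup K => ((χ g : (PadicAlgCl p)ˣ) : PadicAlgCl p) :=
    hc.congr fun g => (eq_mul_inv_apply (A := PadicAlgCl p) (hrχ g)).symm
  have hker : IsOpen (χ.ker : Set (absoluteGaloisGroup K)) := by
    have h1 : (χ.ker : Set (absoluteGaloisGroup K)) =
        (fun g : absoluteGaloisGroup K => ((χ g : (PadicAlgCl p)ˣ) : PadicAlgCl p)) ⁻¹' {-1}ᶜ := by
      ext g
      simp only [SetLike.mem_coe, MonoidHom.mem_ker, Set.mem_preimage, Set.mem_compl_iff,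
        Set.mem_singleton_iff]
      constructor
      · intro hg
        rw [hg, Units.val_one]
        exact fun h => one_ne_zero (CharZero.eq_neg_self_iff.mp h)
      · intro hg
        rcases hpm g with h | h
        · exact Units.val_eq_one.mp h
        · exact absurd h hg
    rw [h1]
    exact isOpen_compl_singleton.preimage hf
  -- Step 2: the complex character `ι ∘ χ` as a rank-one framed Artin representation
  set θ : absoluteGaloisGroup K →* ℂˣ := (Units.map (ι : PadicAlgCl p →* ℂ)).comp χ with hθdef
  have hθ : ∀ g : absoluteGaloisGroup K,
      ((θ g : ℂˣ) : ℂ) = ι ((χ g : (PadicAlgCl p)ˣ) : PadicAlgCl p) := fun g => by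
    rw [hθdef, MonoidHom.comp_apply, Units.coe_map]
    rfl
  have hθker : IsOpen (θ.ker : Set (absoluteGaloisGroup K)) := by
    refine Subgroup.isOpen_mono (fun g hg => ?_) hker
    rw [MonoidHom.mem_ker] at hg ⊢
    rw [hθdef, MonoidHom.comp_apply, hg, map_one]
  obtain ⟨χℂ, hχℂ⟩ : ∃ χℂ : FramedArtinRep K 1, ∀ g : absoluteGaloisGroup K,
      ((χℂ g : GL (Fin 1) ℂ) : Matrix (Fin 1) (Fin 1) ℂ) 0 0 =
        ι ((χ g : (PadicAlgCl p)ˣ) : PadicAlgCl p) :=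
    ⟨ContinuousMonoidHom.comp
        (FramedRep.unitsContinuousMulEquivOfUnique (Fin 1) ℂ : ℂˣ →ₜ* GL (Fin 1) ℂ)
        ⟨θ, Literature.NumberTheory.Automorphic.MonoidHom.continuous_of_isOpen_ker θ hθker⟩,
      fun g => by rw [← hθ g]; rfl⟩
  -- Step 3: Artin reciprocity
  obtain ⟨ω, hωfin, hω⟩ :=
    exists_heckeCharacter_apply_frob_eq artinReciprocity_character_holds χℂ
  -- Step 4: the twist `π ⊗ (ω ∘ det)` realises `σ` at every good place
  refine ⟨hcpt, π.twist ω hωfin, fun w hw => ?_⟩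
  obtain ⟨hσw, α, hα, hrw, hrchar⟩ := hgood w hw
  -- `χℂ` is unramified at `w`
  have hχw : χℂ.IsUnramifiedAt w := by
    intro 𝔓 h𝔓 τ hτ
    have h1 : ((χ τ : (PadicAlgCl p)ˣ) : PadicAlgCl p) = 1 :=
      eq_one_of_eq_smul_conj (A := PadicAlgCl p) (hrw 𝔓 h𝔓 τ hτ) (hσw 𝔓 h𝔓 τ hτ) (hrχ τ)
    refine Units.ext (Matrix.ext fun i j => ?_)
    have hi := Fin.fin_one_eq_zero i
    have hj := Fin.fin_one_eq_zero j
    subst hi hj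
    rw [hχℂ τ, h1, map_one, Units.val_one, Matrix.one_apply_eq]
  obtain ⟨hωw, hωfrob⟩ := hω w hχw
  obtain ⟨𝔪, h𝔪, hw𝔪, hω𝔪⟩ := HeckeCharacter.exists_level_not_dvd_of_isUnramifiedAt 2 hωw
  have hS : (π.twist ω hωfin).1.HasSatakeParamAt w (α.map (ω.valueAtUniformizer w * ·)) :=
    hα.twist_of_isUnramifiedAt hωfin h𝔪 hω𝔪 hw𝔪 hωw
  refine ⟨α.map (ω.valueAtUniformizer w * ·), hS, hσw, ?_⟩
  rw [arithFrobPolyOfSatake_one_map_mul]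
  intro 𝔓 h𝔓 Φ hΦ
  have hrΦ := hrchar 𝔓 h𝔓 Φ hΦ
  rw [arithFrobPolyOfSatake_one_eq_prod_map] at hrΦ
  have hχΦ : ((χ Φ : (PadicAlgCl p)ˣ) : PadicAlgCl p) = ι.symm (ω.valueAtUniformizer w) := by
    rw [← hωfrob 𝔓 h𝔓 Φ hΦ, hχℂ Φ, RingEquiv.symm_apply_apply]
  have hχΦ' : ((χ Φ : (PadicAlgCl p)ˣ) : PadicAlgCl p)⁻¹ = ι.symm (ω.valueAtUniformizer w)⁻¹ := by
    rw [hχΦ, map_inv₀]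
  have key := charpoly_eq_of_eq_smul_conj (A := PadicAlgCl p) (χ Φ).ne_zero (hrχ Φ) hrΦ
  rw [hχΦ'] at key
  exact key

end Summit.Langlands.Langlands.Theorems.ArtinWeightRealisationEven
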